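import Literature.InformationTheory.QuantumCodes.QuantumExpanderNoisySyndromeDecomposition
import HarnessLib

/-!
# Small-set-flip with a NOISY syndrome (Fawzi–Grospellier–Leverrier, FOCS 2018, §3.3), part 2:
# Proposition 14 (a valid flip exists under syndrome noise) and Corollary 16 (the residual error is linear in
# the syndrome error — the adversarial single-shot property of quantum expander codes) — PROOF

Index of sources: `[cite: FawziGrospellierLeverrier2018FT]` = O. Fawzi, A. Grospellier, A. Leverrier, *Constant overhead
quantum fault-tolerance with quantum expander codes*, FOCS 2018, arXiv:1808.03821 (held `paper:arxiv-1808.03821`): §2.4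
eq. (syndromes) (p0011: "the syndromes that are provided as the input of the decoding algorithm are `σ_X := σ_X(E_X) ⊕ D_X`"),
Algorithm 1 of parameter `β` (p0012 L1-10: `𝓕 := {F ⊆ Γ_Z(g) : |σ_X(F)| ≥ (d_A/2)|F|}`, while-condition
"`∃ F ∈ 𝓕 : Δ(σᵢ, F) ≥ β|σ_X(F)|`", `σᵢ₊₁ = σᵢ ⊕ σ_X(Fᵢ) = σ_X(E ⊕ Êᵢ₊₁) ⊕ D`), §3.1 (p0016: `β₀ = 1 − 8δ`, `β₁ = 1 − 16δ`,
`c₀ = 4/(d_A(β₁ − β))`, `c₁ = (β₁ − β)/(β₀(1 − β))`, `c₂ = 2β₀/(β₁ − β)`), §3.3 Prop. 14, Cor. 16 and the proof of Prop. 14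
(p0016 L75 – p0017 L14, p0018 L34-75: eqs. (disjoint), (ineg2), the two bounds on `S = Σᵢ |σ ∩ σ_X(Fᵢ)|`).

Topic `Literature/InformationTheory/QuantumCodes` (venture QEC, row 04 `prover-qec-type-04` gen 8, line L-SSF-NOISY). Vocabulary
and degree dictionary as in part 1 (`QuantumExpanderNoisySyndromeDecomposition.lean`): one error type; `σ_X = expanderHX H *ᵥ ·`;
the syndrome error `D ⊆ C_X = A × B` enters as `𝟙_D = flipVec D`; the observed syndrome is `σ = σ_X(E) ⊕ 𝟙_D`; "`d_A`" (the
smaller degree) is `min Δ_A Δ_B`; `δ = max(δ_A, δ_B)`; the printed radius `|E| ≤ γ₀√n` is the hypothesis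
`max Δ·|E| ≤ min Δ·min(γ_A n_A, γ_B n_B)`; the set `G = {F ∈ 𝓕 : Δ(σ, F) ≥ β|σ_X(F)|}` is written as a `Finset.filter` of
the tree's `smallSets` (nonempty subsets of generators) by the two printed conditions.

* `card_supp_add_flipVec_inter` — `|σ ∩ σ_X(E)| = |σ_X(E)| − |D ∩ σ_X(E)|` for `σ = σ_X(E) ⊕ D`;
* ★ `fgl18b_proposition14` — **Prop. 14** as printed: `Σ_{F ∈ G} |σ_X(F)| ≥ c₁[|σ_X(E)| − c₂|D ∩ σ_X(E)|]`;
  `fgl18b_proposition14_exists` — its first sentence: if `|σ_X(E)| > c₂|D ∩ σ_X(E)|` a valid flip exists;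
* ★ `fgl18b_corollary16` — **Cor. 16**: if the observed syndrome `σ_X(E ⊕ Ê) ⊕ D` passes the halting test of Algorithm 1
  (no `F ∈ 𝓕` with `Δ ≥ β|σ_X(F)|`) and the remaining error `E ⊕ Ê` is reduced with `max Δ·|E ⊕ Ê| ≤ min Δ·min(γ_A n_A, γ_B n_B)`,
  then `|E ⊕ Ê| ≤ c₀·|D ∩ σ_X(E ⊕ Ê)|` — the decoder enters only through its halting condition, exactly as in the printed
  proof ("Since the while loop condition is not satisfied for `σ_f` …");
* `haltingTest_of_ssfHalts`, `fgl18b_corollary16_ssfDecoder` — the same conclusion for EVERY small-set-flip decoder of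
  the tree (`IsSSFDecoder κ`: threshold `κ|F|`, max-ratio rule, any tie-breaking) with `0 < κ`, `2κ < min Δ·β₁`, run on
  the noisy syndrome `σ_X(E) ⊕ 𝟙_D`: with `β = 2κ/min Δ` its halting syndromes pass the printed halting test, so
  `|E ⊕ Ê| ≤ 4|D ∩ σ_X(E ⊕ Ê)|/(min Δ·β₁ − 2κ)`;
* ★ `ssfDecoder_residual_le_of_syndromeError` — the ADVERSARIAL SINGLE-SHOT GUARANTEE with both side conditions of
  Cor. 16 discharged (OURS as a packaging): if `max Δ·(|E| + (max Δ|E| + |D|)/κ) ≤ min Δ·min(γ_A n_A, γ_B n_B)` then the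
  residual `E ⊕ Ê` of every such decoder run on `σ_X(E) ⊕ 𝟙_D` is equivalent modulo `C_Z^⊥` to a word of weight
  `≤ 4|D|/(min Δ·β₁ − 2κ)` (apply Cor. 16 to the reduced representative of `E ⊕ Ê`, which has the same halting syndrome
  and weight `≤ |E| + |Ê| ≤ |E| + (max Δ|E| + |D|)/κ` by the run accounting);
  `ssfDecoder_residual_le_of_syndromeError_zsector` — the same for the other error type of `Q_G` (reversed graph,
  transported along the block swap; `SmallSetFlipRelabel.lean`).

HONEST FRAMING: Prop. 14, Cor. 16 and the constants are the printed ones (modulo the dictionary); `fgl18b_corollary16_ssfDecoder`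
is the transport to the tree's decoder family and `ssfDecoder_residual_le_of_syndromeError` a deterministic packaging (both ours
in that bookkeeping sense; the paper discharges "`E ⊕ Ê` reduced and small" probabilistically for linear-size random errors in
§3.4 / Thm. 13, not ported). Column word: PROVED (kernel); no definitions, no named facts.
-/

namespace Literature.InformationTheory.QuantumCodes

namespace QuantumExpander

open Finset Matrix

variable {A B : Type*} [Fintype A] [Fintype B] [DecidableEq A] [DecidableEq B]

/-! ### Two counting lemmas -/

/-- The support of a finite sum of `𝔽₂`-vectors lies in the union of the supports. [folklore] -/
private theorem filter_sum_ne_zero_subset_biUnion {ι C : Type*} [Fintype C] [DecidableEq C] [DecidableEq ι]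
    (L : Finset ι) (v : ι → C → ZMod 2) :
    (univ.filter fun c => (∑ i ∈ L, v i) c ≠ 0) ⊆ L.biUnion fun i => univ.filter fun c => v i c ≠ 0 := by
  classical
  intro c hc
  rw [Finset.mem_filter] at hc
  rw [Finset.mem_biUnion]
  by_contra hnone
  push Not at hnone
  apply hc.2
  rw [Finset.sum_apply]
  refine Finset.sum_eq_zero fun i hi => ?_
  by_contra hne
  exact hnone i hi (by simpa using hne)

omit [Fintype A] [Fintype B] [DecidableEq A] [DecidableEq B] in
/-- **`|σ ∩ σ_X(E)| = |σ_X(E)| − |D ∩ σ_X(E)|` for the observed syndrome `σ = σ_X(E) ⊕ D`** ("`|(σ_X(E) ⊕ D) ∩ σ_X(E)|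
= |σ_X(E) ⊕ (D ∩ σ_X(E))| = |σ_X(E)| − |D ∩ σ_X(E)|`"), for any `0/1`-vector `τ` in place of `σ_X(E)`.
[cite: FawziGrospellierLeverrier2018FT, proof of Prop 14, lower bound on S (arXiv p0018 L68-73)] -/
theorem card_supp_add_flipVec_inter {C : Type*} [Fintype C] [DecidableEq C] (τ : C → ZMod 2) (D : Finset C) :
    ((univ.filter fun c => (τ + flipVec D) c ≠ 0) ∩ (univ.filter fun c => τ c ≠ 0)).card
      + (D ∩ univ.filter fun c => τ c ≠ 0).card = (univ.filter fun c => τ c ≠ 0).card := by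
  classical
  have h01 : ∀ z : ZMod 2, z ≠ 0 → z = 1 := by decide
  have h11 : (1 : ZMod 2) + 1 = 0 := by decide
  have h1 : (univ.filter fun c => (τ + flipVec D) c ≠ 0) ∩ (univ.filter fun c => τ c ≠ 0)
      = (univ.filter fun c => τ c ≠ 0).filter fun c => c ∉ D := by
    ext c
    simp only [Finset.mem_inter, Finset.mem_filter, Finset.mem_univ, true_and, Pi.add_apply, flipVec]
    constructor
    · rintro ⟨hσ, hτ⟩
      refine ⟨hτ, fun hD => ?_⟩
      rw [h01 _ hτ, if_pos hD, h11] at hσ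
      exact hσ rfl
    · rintro ⟨hτ, hD⟩
      refine ⟨?_, hτ⟩
      rw [if_neg hD, add_zero]
      exact hτ
  have h2 : D ∩ (univ.filter fun c => τ c ≠ 0) = (univ.filter fun c => τ c ≠ 0).filter fun c => c ∈ D := by
    ext c
    simp only [Finset.mem_inter, Finset.mem_filter, Finset.mem_univ, true_and]
    tauto
  rw [h1, h2, add_comm]
  exact Finset.card_filter_add_card_filter_not _

/-! ### Proposition 14 -/

/-- **FGL18b Proposition 14** (a valid flip exists under syndrome noise), AS PRINTED modulo the dictionary of part 1.
For a `(Δ_A, Δ_B)`-biregular (`Δ ≥ 1`) `(γ_A, δ_A, γ_B, δ_B)`-expanding graph (`δ_A, δ_B ≥ 0`, `δ = max(δ_A, δ_B)`,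
`β₀ = 1 − 8δ`, `β₁ = 1 − 16δ`), a parameter `β ∈ [0, β₁)` (so `δ < 1/16`), a qubit error `E` with
`max Δ·|E| ≤ min Δ·min(γ_A n_A, γ_B n_B)` (printed: `|E| ≤ γ₀√n`) and ANY syndrome error `D ⊆ C_X`: with the observed
syndrome `σ = σ_X(E) ⊕ D` and `G = {F ∈ 𝓕 : Δ(σ, F) ≥ β|σ_X(F)|}` (`𝓕` = nonempty subsets `F` of generators with
`|σ_X(F)| ≥ (min Δ/2)|F|`),
`Σ_{F ∈ G} |σ_X(F)| ≥ c₁[|σ_X(E)| − c₂|D ∩ σ_X(E)|]`, `c₁ = (β₁ − β)/(β₀(1 − β))`, `c₂ = 2β₀/(β₁ − β)`.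
Proof as printed: decompose the `‖·‖`-reduced representative `E₀ = ⊎Fᵢ` (part 1); eq. (disjoint)
`β₀ Σᵢ|σ_X(Fᵢ)| ≤ |σ_X(E)|`; `Δ(σ, F) = 2|σ ∩ σ_X(F)| − |σ_X(F)|` gives (ineg2) `|σ ∩ σ_X(Fᵢ)| ≤ ((1+β)/2)|σ_X(Fᵢ)|` off
`G`; and `Σᵢ |σ ∩ σ_X(Fᵢ)| ≥ |σ ∩ σ_X(E)| = |σ_X(E)| − |D ∩ σ_X(E)|` since `σ_X(E) = ⊕ᵢ σ_X(Fᵢ)`.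
[cite: FawziGrospellierLeverrier2018FT, Prop 14 (arXiv p0016 L75-87) and its proof (p0018 L34-75)] -/
theorem fgl18b_proposition14 (H : Matrix B A (ZMod 2)) {dA dB : ℕ} {γA δA γB δB : ℝ}
    (hreg : IsBiregular H dA dB) (hexp : IsLeftRightExpanding H dA dB γA δA γB δB)
    (hdA : 0 < dA) (hdB : 0 < dB) (hδA : 0 ≤ δA) (hδB : 0 ≤ δB)
    {β : ℝ} (hβ0 : 0 ≤ β) (hβ1 : β < 1 - 16 * max δA δB)
    (e : (A × A) ⊕ (B × B) → ZMod 2) (D : Finset (A × B))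
    (hw : ((max dA dB : ℕ) : ℝ) * hammingNorm e
      ≤ ((min dA dB : ℕ) : ℝ) * min (γA * Fintype.card A) (γB * Fintype.card B)) :
    (1 - 16 * max δA δB - β) / ((1 - 8 * max δA δB) * (1 - β))
        * ((hammingNorm (expanderHX H *ᵥ e) : ℝ)
            - 2 * (1 - 8 * max δA δB) / (1 - 16 * max δA δB - β)
              * ((D ∩ univ.filter fun c => (expanderHX H *ᵥ e) c ≠ 0).card : ℝ))
      ≤ ∑ F ∈ (smallSets (expanderHZ H)).filter (fun F =>
            ((min dA dB : ℕ) : ℝ) / 2 * F.card ≤ hammingNorm (expanderHX H *ᵥ flipVec F) ∧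
            β * hammingNorm (expanderHX H *ᵥ flipVec F)
              ≤ syndromeDecrease (expanderHX H) (expanderHX H *ᵥ e + flipVec D) F),
          (hammingNorm (expanderHX H *ᵥ flipVec F) : ℝ) := by
  classical
  have hδ0 : 0 ≤ max δA δB := le_max_of_le_left hδA
  have hβ₀ : 0 < 1 - 8 * max δA δB := by linarith
  have hβ₁β : 0 < 1 - 16 * max δA δB - β := by linarith
  have h1β : 0 < 1 - β := by linarith
  have hdm0 : 0 < min dA dB := lt_min hdA hdB
  have hdm' : (0 : ℝ) < ((min dA dB : ℕ) : ℝ) := by exact_mod_cast hdm0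
  -- Step 0: the `‖·‖`-reduced representative `E₀` of `E + C_Z^⊥` (same syndrome) and its critical decomposition
  obtain ⟨e₀, he₀, hmin⟩ := exists_wnorm_min (expanderHZ H) (wnorm dA dB) e
  have hred₀ : ∀ u ∈ rowSpace (expanderHZ H), wnorm dA dB e₀ ≤ wnorm dA dB (e₀ + u) := by
    intro u hu
    refine hmin _ ?_
    have : e₀ + u - e = (e₀ - e) + u := by abel
    rw [this]
    exact Submodule.add_mem _ he₀ hu
  have hsyn : expanderHX H *ᵥ e₀ = expanderHX H *ᵥ e := by
    have h0 := expanderHX_mulVec_eq_zero_of_mem_rowSpace H he₀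
    rw [Matrix.mulVec_sub, sub_eq_zero] at h0
    exact h0
  have hcard0 : (hammingNorm e₀ : ℝ) ≤ min (γA * Fintype.card A) (γB * Fintype.card B) := by
    have h1 : min dA dB * hammingNorm e₀ ≤ wnorm dA dB e₀ := (hammingNorm_le_wnorm_minmax dA dB e₀).1
    have h2 : wnorm dA dB e₀ ≤ wnorm dA dB e := hmin e (by simp)
    have h3 : wnorm dA dB e ≤ max dA dB * hammingNorm e := (hammingNorm_le_wnorm_minmax dA dB e).2
    have h4 : (((min dA dB : ℕ) : ℝ) * hammingNorm e₀) ≤ ((max dA dB : ℕ) : ℝ) * hammingNorm e := by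
      exact_mod_cast h1.trans (h2.trans h3)
    exact le_of_mul_le_mul_left (h4.trans hw) hdm'
  obtain ⟨L, hsum, hmem, hwsum, hσ⟩ := exists_critical_decomposition H hreg hexp hdA hdB hδA hδB e₀ hred₀
    (hcard0.trans (min_le_left _ _)) (hcard0.trans (min_le_right _ _))
  rw [hsyn] at hσ
  -- names
  set δ : ℝ := max δA δB with hδdef
  set dm : ℕ := min dA dB with hdm
  set τ := expanderHX H *ᵥ e with hτdef
  set σ := τ + flipVec D with hσdef
  set X : ℝ := ((D ∩ univ.filter fun c => τ c ≠ 0).card : ℝ) with hXdef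
  set G := (smallSets (expanderHZ H)).filter (fun F =>
      (dm : ℝ) / 2 * F.card ≤ hammingNorm (expanderHX H *ᵥ flipVec F) ∧
      β * hammingNorm (expanderHX H *ᵥ flipVec F) ≤ syndromeDecrease (expanderHX H) σ F) with hGdef
  -- Step 1 (eq. (robust), summed): `(1/2 − 4δ)·Σ_𝓛 Δ_AΔ_B‖F‖ ≤ |σ_X(E)|`
  have hW : (1 / 2 - 4 * δ) * (∑ F ∈ L, (wnorm dA dB (flipVec F) : ℝ)) ≤ hammingNorm τ := by
    have hterm : ∀ F ∈ L, (1 / 2 - 4 * δ) * (wnorm dA dB (flipVec F) : ℝ)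
        ≤ (hammingNorm (expanderHX H *ᵥ flipVec F) : ℝ) - 4 * δ * wnorm dA dB (flipVec F) := by
      intro F hF
      have h := (hmem F hF).2.2
      have h' : (wnorm dA dB (flipVec F) : ℝ) ≤ 2 * hammingNorm (expanderHX H *ᵥ flipVec F) := by
        exact_mod_cast h
      linarith
    have h := Finset.sum_le_sum hterm
    rw [← Finset.mul_sum] at h
    exact h.trans hσ
  -- Step 2 (eq. (disjoint)): `β₀ Σ_𝓛 |σ_X(F)| ≤ |σ_X(E)|`
  have hdisj : (1 - 8 * δ) * (∑ F ∈ L, (hammingNorm (expanderHX H *ᵥ flipVec F) : ℝ)) ≤ hammingNorm τ := by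
    have hsplit : (∑ F ∈ L, ((hammingNorm (expanderHX H *ᵥ flipVec F) : ℝ) - 4 * δ * wnorm dA dB (flipVec F)))
        = (∑ F ∈ L, (hammingNorm (expanderHX H *ᵥ flipVec F) : ℝ))
          - 4 * δ * ∑ F ∈ L, (wnorm dA dB (flipVec F) : ℝ) := by
      rw [Finset.sum_sub_distrib, Finset.mul_sum]
    rw [hsplit] at hσ
    have hWnn : 0 ≤ ∑ F ∈ L, (wnorm dA dB (flipVec F) : ℝ) := Finset.sum_nonneg fun F _ => Nat.cast_nonneg _
    have hp1 := mul_le_mul_of_nonneg_left hσ hβ₀.le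
    have hp2 := mul_le_mul_of_nonneg_left hW (by positivity : (0 : ℝ) ≤ 8 * δ)
    linarith
  -- Step 3 (ineg2): for `F ∈ 𝓛`, `|σ ∩ σ_X(F)| ≤ ((1+β)/2)|σ_X(F)| + [F ∈ G]·((1−β)/2)|σ_X(F)|`
  have haF : ∀ F ∈ L,
      ((((univ.filter fun c => σ c ≠ 0) ∩ (univ.filter fun c => (expanderHX H *ᵥ flipVec F) c ≠ 0)).card : ℝ))
        ≤ (1 + β) / 2 * hammingNorm (expanderHX H *ᵥ flipVec F)
          + (if F ∈ G then (1 - β) / 2 * (hammingNorm (expanderHX H *ᵥ flipVec F) : ℝ) else 0) := by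
    intro F hF
    obtain ⟨hFsmall, -, hFw⟩ := hmem F hF
    have hale : ((((univ.filter fun c => σ c ≠ 0)
        ∩ (univ.filter fun c => (expanderHX H *ᵥ flipVec F) c ≠ 0)).card : ℝ))
        ≤ hammingNorm (expanderHX H *ᵥ flipVec F) := by
      have : ((univ.filter fun c => σ c ≠ 0) ∩ (univ.filter fun c => (expanderHX H *ᵥ flipVec F) c ≠ 0)).card
          ≤ (univ.filter fun c => (expanderHX H *ᵥ flipVec F) c ≠ 0).card :=
        Finset.card_le_card Finset.inter_subset_right
      exact_mod_cast this
    by_cases hG : F ∈ G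
    · rw [if_pos hG]; linarith
    · rw [if_neg hG, add_zero]
      -- `F ∈ 𝓕` but `F ∉ G`: `Δ(σ, F) < β|σ_X(F)|`, i.e. `2|σ ∩ σ_X(F)| − |σ_X(F)| < β|σ_X(F)|`
      have hcalF : (dm : ℝ) / 2 * F.card ≤ hammingNorm (expanderHX H *ᵥ flipVec F) := by
        have h1 : dm * hammingNorm (flipVec F) ≤ wnorm dA dB (flipVec F) :=
          (hammingNorm_le_wnorm_minmax dA dB (flipVec F)).1
        rw [hammingNorm_flipVec] at h1
        have h1' : ((dm : ℝ) * F.card) ≤ wnorm dA dB (flipVec F) := by exact_mod_cast h1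
        have h2 : (wnorm dA dB (flipVec F) : ℝ) ≤ 2 * hammingNorm (expanderHX H *ᵥ flipVec F) := by
          exact_mod_cast hFw
        linarith
      have hnot : ¬ (β * hammingNorm (expanderHX H *ᵥ flipVec F)
          ≤ (syndromeDecrease (expanderHX H) σ F : ℝ)) := by
        intro hle
        exact hG (Finset.mem_filter.2 ⟨hFsmall, hcalF, hle⟩)
      have hdecR : (syndromeDecrease (expanderHX H) σ F : ℝ)
          = 2 * (((univ.filter fun c => σ c ≠ 0)
              ∩ (univ.filter fun c => (expanderHX H *ᵥ flipVec F) c ≠ 0)).card : ℝ)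
            - hammingNorm (expanderHX H *ᵥ flipVec F) := by
        rw [SmallSetFlip.syndromeDecrease_eq (expanderHX H) σ F]; push_cast; ring
      rw [hdecR] at hnot
      push Not at hnot
      linarith
  -- Step 4: summing, `S ≤ ((1+β)/2) Σ_𝓛 |σ_X(F)| + ((1−β)/2) Σ_{𝓛 ∩ G} |σ_X(F)|`
  have hS_le : (∑ F ∈ L, ((((univ.filter fun c => σ c ≠ 0)
        ∩ (univ.filter fun c => (expanderHX H *ᵥ flipVec F) c ≠ 0)).card : ℝ)))
      ≤ (1 + β) / 2 * (∑ F ∈ L, (hammingNorm (expanderHX H *ᵥ flipVec F) : ℝ))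
        + (1 - β) / 2 * ∑ F ∈ L.filter (fun F => F ∈ G), (hammingNorm (expanderHX H *ᵥ flipVec F) : ℝ) := by
    have h := Finset.sum_le_sum haF
    rw [Finset.sum_add_distrib, ← Finset.mul_sum, ← Finset.sum_filter, ← Finset.mul_sum] at h
    exact h
  -- Step 5: `Σ_{𝓛 ∩ G} ≤ Σ_G` (nonnegative terms)
  have hTle : (∑ F ∈ L.filter (fun F => F ∈ G), (hammingNorm (expanderHX H *ᵥ flipVec F) : ℝ))
      ≤ ∑ F ∈ G, (hammingNorm (expanderHX H *ᵥ flipVec F) : ℝ) := by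
    refine Finset.sum_le_sum_of_subset_of_nonneg ?_ (fun F _ _ => Nat.cast_nonneg _)
    intro F hF
    exact (Finset.mem_filter.1 hF).2
  -- Step 6: `S ≥ |σ ∩ σ_X(E)| = |σ_X(E)| − |D ∩ σ_X(E)|`, since `σ_X(E) = ⊕_𝓛 σ_X(F)`
  have hS_ge : (hammingNorm τ : ℝ) - X
      ≤ ∑ F ∈ L, ((((univ.filter fun c => σ c ≠ 0)
          ∩ (univ.filter fun c => (expanderHX H *ᵥ flipVec F) c ≠ 0)).card : ℝ)) := by
    have hτsum : τ = ∑ F ∈ L, expanderHX H *ᵥ flipVec F := by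
      rw [← hsyn, ← hsum, Matrix.mulVec_sum]
    have hcover : (univ.filter fun c => σ c ≠ 0) ∩ (univ.filter fun c => τ c ≠ 0)
        ⊆ L.biUnion fun F => (univ.filter fun c => σ c ≠ 0)
            ∩ (univ.filter fun c => (expanderHX H *ᵥ flipVec F) c ≠ 0) := by
      intro c hc
      rw [Finset.mem_inter] at hc
      have h2 := hc.2
      rw [hτsum] at h2
      have h3 := filter_sum_ne_zero_subset_biUnion L (fun F => expanderHX H *ᵥ flipVec F) h2
      rw [Finset.mem_biUnion] at h3 ⊢
      obtain ⟨F, hF, hcF⟩ := h3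
      exact ⟨F, hF, Finset.mem_inter.2 ⟨hc.1, hcF⟩⟩
    have hcardle := (Finset.card_le_card hcover).trans Finset.card_biUnion_le
    have hpart := card_supp_add_flipVec_inter τ D
    have hτn : (univ.filter fun c => τ c ≠ 0).card = hammingNorm τ := rfl
    rw [hτn] at hpart
    have hpartR : ((((univ.filter fun c => σ c ≠ 0) ∩ (univ.filter fun c => τ c ≠ 0)).card : ℝ)) + X
        = hammingNorm τ := by
      rw [hXdef, hσdef]; exact_mod_cast hpart
    have hcardleR : ((((univ.filter fun c => σ c ≠ 0) ∩ (univ.filter fun c => τ c ≠ 0)).card : ℝ))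
        ≤ ∑ F ∈ L, ((((univ.filter fun c => σ c ≠ 0)
            ∩ (univ.filter fun c => (expanderHX H *ᵥ flipVec F) c ≠ 0)).card : ℝ)) := by
      exact_mod_cast hcardle
    linarith
  -- Step 7: the arithmetic `(β₁ − β)|σ_X(E)| − 2β₀|D ∩ σ_X(E)| ≤ β₀(1 − β)·Σ_G |σ_X(F)|`
  have hkey : (1 - 16 * δ - β) * hammingNorm τ - 2 * (1 - 8 * δ) * X
      ≤ (1 - 8 * δ) * (1 - β) * ∑ F ∈ G, (hammingNorm (expanderHX H *ᵥ flipVec F) : ℝ) := by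
    have hmain := hS_ge.trans hS_le
    have hp3 := mul_le_mul_of_nonneg_left hmain (by linarith : (0 : ℝ) ≤ 2 * (1 - 8 * δ))
    have hp1 := mul_le_mul_of_nonneg_left hdisj (by linarith : (0 : ℝ) ≤ 1 + β)
    have hp2 := mul_le_mul_of_nonneg_left hTle (by positivity : (0 : ℝ) ≤ (1 - 8 * δ) * (1 - β))
    linarith
  have hfrac : (1 - 16 * δ - β) / ((1 - 8 * δ) * (1 - β))
        * ((hammingNorm τ : ℝ) - 2 * (1 - 8 * δ) / (1 - 16 * δ - β) * X)
      = ((1 - 16 * δ - β) * hammingNorm τ - 2 * (1 - 8 * δ) * X) / ((1 - 8 * δ) * (1 - β)) := by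
    field_simp
  rw [hfrac, div_le_iff₀ (by positivity)]
  linarith

/-- **FGL18b Proposition 14, first sentence**: under the hypotheses of `fgl18b_proposition14`, if
`|σ_X(E)| > c₂|D ∩ σ_X(E)|` then at least one valid flip exists for Algorithm 1 of parameter `β` at the observed
syndrome `σ = σ_X(E) ⊕ D` — some `F ∈ 𝓕` (a nonempty subset of a generator with `|σ_X(F)| ≥ (min Δ/2)|F|`) has
`Δ(σ, F) ≥ β|σ_X(F)|`. [cite: FawziGrospellierLeverrier2018FT, Prop 14 (arXiv p0016 L75-80)] -/
theorem fgl18b_proposition14_exists (H : Matrix B A (ZMod 2)) {dA dB : ℕ} {γA δA γB δB : ℝ}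
    (hreg : IsBiregular H dA dB) (hexp : IsLeftRightExpanding H dA dB γA δA γB δB)
    (hdA : 0 < dA) (hdB : 0 < dB) (hδA : 0 ≤ δA) (hδB : 0 ≤ δB)
    {β : ℝ} (hβ0 : 0 ≤ β) (hβ1 : β < 1 - 16 * max δA δB)
    (e : (A × A) ⊕ (B × B) → ZMod 2) (D : Finset (A × B))
    (hw : ((max dA dB : ℕ) : ℝ) * hammingNorm e
      ≤ ((min dA dB : ℕ) : ℝ) * min (γA * Fintype.card A) (γB * Fintype.card B))
    (hD : 2 * (1 - 8 * max δA δB) / (1 - 16 * max δA δB - β)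
        * ((D ∩ univ.filter fun c => (expanderHX H *ᵥ e) c ≠ 0).card : ℝ)
      < hammingNorm (expanderHX H *ᵥ e)) :
    ∃ F ∈ smallSets (expanderHZ H),
      ((min dA dB : ℕ) : ℝ) / 2 * F.card ≤ hammingNorm (expanderHX H *ᵥ flipVec F) ∧
      β * hammingNorm (expanderHX H *ᵥ flipVec F)
        ≤ syndromeDecrease (expanderHX H) (expanderHX H *ᵥ e + flipVec D) F := by
  classical
  have h14 := fgl18b_proposition14 H hreg hexp hdA hdB hδA hδB hβ0 hβ1 e D hw
  have hδ0 : 0 ≤ max δA δB := le_max_of_le_left hδA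
  have hc₁ : 0 < (1 - 16 * max δA δB - β) / ((1 - 8 * max δA δB) * (1 - β)) := by
    apply div_pos <;> nlinarith
  have hpos : 0 < (1 - 16 * max δA δB - β) / ((1 - 8 * max δA δB) * (1 - β))
      * ((hammingNorm (expanderHX H *ᵥ e) : ℝ)
          - 2 * (1 - 8 * max δA δB) / (1 - 16 * max δA δB - β)
            * ((D ∩ univ.filter fun c => (expanderHX H *ᵥ e) c ≠ 0).card : ℝ)) :=
    mul_pos hc₁ (by linarith)
  have hsum_pos := hpos.trans_le h14
  by_contra hnone
  have hempty : (smallSets (expanderHZ H)).filter (fun F =>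
      ((min dA dB : ℕ) : ℝ) / 2 * F.card ≤ hammingNorm (expanderHX H *ᵥ flipVec F) ∧
      β * hammingNorm (expanderHX H *ᵥ flipVec F)
        ≤ syndromeDecrease (expanderHX H) (expanderHX H *ᵥ e + flipVec D) F) = ∅ := by
    rw [Finset.filter_eq_empty_iff]
    intro F hF hcond
    exact hnone ⟨F, hF, hcond.1, hcond.2⟩
  rw [hempty, Finset.sum_empty] at hsum_pos
  exact lt_irrefl _ hsum_pos

/-! ### Corollary 16: the residual error is linear in the syndrome error -/

/-- **FGL18b Corollary 16** (single-shot residual-error bound). Hypotheses: a `(Δ_A, Δ_B)`-biregular (`Δ ≥ 1`)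
`(γ_A, δ_A, γ_B, δ_B)`-expanding graph, `δ = max(δ_A, δ_B) ≥ 0`, `β ∈ [0, β₁)`, a qubit error `E`, a syndrome error
`D`, and a correction `Ê` at which Algorithm 1 of parameter `β` HALTS on the observed syndrome
`σ_f = σ_X(E ⊕ Ê) ⊕ D` ("the while loop condition is not satisfied for `σ_f`": no `F ∈ 𝓕` with
`Δ(σ_f, F) ≥ β|σ_X(F)|`); if the remaining error `E ⊕ Ê` is reduced with `max Δ·|E ⊕ Ê| ≤ min Δ·min(γ_A n_A, γ_B n_B)`
(printed: `|E ⊕ Ê| ≤ γ₀√n`) then `|E ⊕ Ê| ≤ c₀·|D ∩ σ_X(E ⊕ Ê)|`, `c₀ = 4/(min Δ·(β₁ − β))` (printed `4/(d_A(β₁ − β))`).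
Proof as printed: the contraposition of Prop. 14 gives `|σ_X(E ⊕ Ê)| ≤ c₂|D ∩ σ_X(E ⊕ Ê)|`, and Lemma 15 gives
`|σ_X(E ⊕ Ê)| ≥ (β₀ min Δ/2)|E ⊕ Ê|`. [cite: FawziGrospellierLeverrier2018FT, Cor 16 and its proof (arXiv p0016 L97 – p0017 L14)] -/
theorem fgl18b_corollary16 (H : Matrix B A (ZMod 2)) {dA dB : ℕ} {γA δA γB δB : ℝ}
    (hreg : IsBiregular H dA dB) (hexp : IsLeftRightExpanding H dA dB γA δA γB δB)
    (hdA : 0 < dA) (hdB : 0 < dB) (hδA : 0 ≤ δA) (hδB : 0 ≤ δB)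
    {β : ℝ} (hβ0 : 0 ≤ β) (hβ1 : β < 1 - 16 * max δA δB)
    (e Ehat : (A × A) ⊕ (B × B) → ZMod 2) (D : Finset (A × B))
    (hhalt : ∀ F ∈ smallSets (expanderHZ H),
      ((min dA dB : ℕ) : ℝ) / 2 * F.card ≤ hammingNorm (expanderHX H *ᵥ flipVec F) →
      ¬ (β * hammingNorm (expanderHX H *ᵥ flipVec F)
          ≤ syndromeDecrease (expanderHX H) (expanderHX H *ᵥ (e + Ehat) + flipVec D) F))
    (hred : ∀ u ∈ rowSpace (expanderHZ H), hammingNorm (e + Ehat) ≤ hammingNorm (e + Ehat + u))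
    (hw : ((max dA dB : ℕ) : ℝ) * hammingNorm (e + Ehat)
      ≤ ((min dA dB : ℕ) : ℝ) * min (γA * Fintype.card A) (γB * Fintype.card B)) :
    (hammingNorm (e + Ehat) : ℝ)
      ≤ 4 / (((min dA dB : ℕ) : ℝ) * (1 - 16 * max δA δB - β))
        * ((D ∩ univ.filter fun c => (expanderHX H *ᵥ (e + Ehat)) c ≠ 0).card : ℝ) := by
  classical
  have hδ0 : 0 ≤ max δA δB := le_max_of_le_left hδA
  have hβ₀ : 0 < 1 - 8 * max δA δB := by linarith
  have hβ₁β : 0 < 1 - 16 * max δA δB - β := by linarith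
  have hdm' : (0 : ℝ) < ((min dA dB : ℕ) : ℝ) := by exact_mod_cast lt_min hdA hdB
  set X : ℝ := ((D ∩ univ.filter fun c => (expanderHX H *ᵥ (e + Ehat)) c ≠ 0).card : ℝ) with hXdef
  -- contraposition of Prop. 14: `|σ_X(E ⊕ Ê)| ≤ c₂ |D ∩ σ_X(E ⊕ Ê)|`
  have h14 : (hammingNorm (expanderHX H *ᵥ (e + Ehat)) : ℝ)
      ≤ 2 * (1 - 8 * max δA δB) / (1 - 16 * max δA δB - β) * X := by
    by_contra hlt
    push Not at hlt
    obtain ⟨F, hF, hcal, hdec⟩ :=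
      fgl18b_proposition14_exists H hreg hexp hdA hdB hδA hδB hβ0 hβ1 (e + Ehat) D hw hlt
    exact hhalt F hF hcal hdec
  -- Lemma 15: `(β₀ min Δ/2)|E ⊕ Ê| ≤ |σ_X(E ⊕ Ê)|`
  have h15 := fgl18b_lemma15 H hreg hexp hdA hdB hδA hδB hred hw
  have hX0 : 0 ≤ X := Nat.cast_nonneg _
  -- combine: `(β₀ min Δ/2)|E ⊕ Ê|·(β₁ − β) ≤ |σ_X(E ⊕ Ê)|·(β₁ − β) ≤ 2β₀ |D ∩ σ_X(E ⊕ Ê)|`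
  have hc2 : 2 * (1 - 8 * max δA δB) / (1 - 16 * max δA δB - β) * X
      = (2 * (1 - 8 * max δA δB) * X) / (1 - 16 * max δA δB - β) := by ring
  rw [hc2, le_div_iff₀ hβ₁β] at h14
  have h15' := mul_le_mul_of_nonneg_right h15 hβ₁β.le
  have hmain : (1 - 8 * max δA δB)
        * (((min dA dB : ℕ) : ℝ) * hammingNorm (e + Ehat) * (1 - 16 * max δA δB - β))
      ≤ (1 - 8 * max δA δB) * (4 * X) := by
    have := h15'.trans h14
    linarith
  have hmain' := le_of_mul_le_mul_left hmain hβ₀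
  rw [div_mul_eq_mul_div, le_div_iff₀ (mul_pos hdm' hβ₁β)]
  linarith

/-- **The tree's halting condition implies the printed one.** If a syndrome `σ` is HALTING for the tree's small-set-flip
decoder with threshold `κ > 0` (no nonempty `F ⊆` generator with positive decrease `≥ κ|F|`), then it passes the halting
test of FGL18b's Algorithm 1 with `β = 2κ/min Δ`: no `F ∈ 𝓕` (`|σ_X(F)| ≥ (min Δ/2)|F|`) has `Δ(σ, F) ≥ β|σ_X(F)|` —
such an `F` would have `Δ(σ, F) ≥ κ|F| > 0`. [cite: FawziGrospellierLeverrier2018FT, Algorithm 1 (while condition; arXiv p0012 L1-8)] -/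
theorem haltingTest_of_ssfHalts (H : Matrix B A (ZMod 2)) {dA dB : ℕ} (hdA : 0 < dA) (hdB : 0 < dB)
    {κ : ℝ} (hκ0 : 0 < κ) {σ : A × B → ZMod 2} (hh : SSFHalts κ (expanderHX H) (expanderHZ H) σ) :
    ∀ F ∈ smallSets (expanderHZ H),
      ((min dA dB : ℕ) : ℝ) / 2 * F.card ≤ hammingNorm (expanderHX H *ᵥ flipVec F) →
      ¬ (2 * κ / ((min dA dB : ℕ) : ℝ) * hammingNorm (expanderHX H *ᵥ flipVec F)
          ≤ syndromeDecrease (expanderHX H) σ F) := by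
  intro F hF hcal hdec
  have hdm' : (0 : ℝ) < ((min dA dB : ℕ) : ℝ) := by exact_mod_cast lt_min hdA hdB
  have hFpos : (0 : ℝ) < F.card := by exact_mod_cast card_pos_of_mem_smallSets hF
  have hκF : κ * F.card ≤ 2 * κ / ((min dA dB : ℕ) : ℝ) * hammingNorm (expanderHX H *ᵥ flipVec F) := by
    have : κ * (F.card : ℝ) = 2 * κ / ((min dA dB : ℕ) : ℝ) * (((min dA dB : ℕ) : ℝ) / 2 * F.card) := by
      field_simp
    rw [this]
    exact mul_le_mul_of_nonneg_left hcal (by positivity)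
  have hge : κ * F.card ≤ (syndromeDecrease (expanderHX H) σ F : ℝ) := hκF.trans hdec
  have hposR : (0 : ℝ) < syndromeDecrease (expanderHX H) σ F := lt_of_lt_of_le (mul_pos hκ0 hFpos) hge
  have hpos : 0 < syndromeDecrease (expanderHX H) σ F := by exact_mod_cast hposR
  exact hh F hF ⟨hpos, hge⟩

/-- **Corollary 16 for the tree's small-set-flip decoders.** Every small-set-flip decoder in the sense of the tree
(`IsSSFDecoder κ`: flips a nonempty subset `F` of a generator whose syndrome-weight decrease is positive and `≥ κ|F|`,
maximising the ratio, any tie-breaking; output = the flips of SOME complete run) with `0 < κ` and `2κ < min Δ·β₁`, run on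
the NOISY syndrome `σ_X(E) ⊕ 𝟙_D` (FGL18b eq. (syndromes)), halts at `σ_X(E ⊕ Ê) ⊕ 𝟙_D`, and that syndrome passes the
halting test of Algorithm 1 with `β = 2κ/min Δ` (a flip `F ∈ 𝓕` with `Δ ≥ β|σ_X(F)| ≥ κ|F| > 0` would be a valid step);
hence, if `E ⊕ Ê` is reduced with `max Δ·|E ⊕ Ê| ≤ min Δ·min(γ_A n_A, γ_B n_B)`, then
`|E ⊕ Ê| ≤ 4|D ∩ σ_X(E ⊕ Ê)|/(min Δ·β₁ − 2κ)` (`= c₀` at `β = 2κ/min Δ`). The transport to the tree's decoder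
family is ours; the content is Cor. 16. [cite: FawziGrospellierLeverrier2018FT, Cor 16 (arXiv p0016 L97 – p0017 L14); Algorithm 1 and eq. (syndromes) (p0011–p0012)] -/
theorem fgl18b_corollary16_ssfDecoder (H : Matrix B A (ZMod 2)) {dA dB : ℕ} {γA δA γB δB : ℝ}
    (hreg : IsBiregular H dA dB) (hexp : IsLeftRightExpanding H dA dB γA δA γB δB)
    (hdA : 0 < dA) (hdB : 0 < dB) (hδA : 0 ≤ δA) (hδB : 0 ≤ δB)
    {κ : ℝ} (hκ0 : 0 < κ) (hκ1 : 2 * κ < ((min dA dB : ℕ) : ℝ) * (1 - 16 * max δA δB))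
    (Dec : Decoder (A × B → ZMod 2) ((A × A) ⊕ (B × B) → ZMod 2))
    (hDec : IsSSFDecoder κ (expanderHX H) (expanderHZ H) Dec)
    (e : (A × A) ⊕ (B × B) → ZMod 2) (D : Finset (A × B)) {Ehat : (A × A) ⊕ (B × B) → ZMod 2}
    (hout : Dec (expanderHX H *ᵥ e + flipVec D) = Ehat)
    (hred : ∀ u ∈ rowSpace (expanderHZ H), hammingNorm (e + Ehat) ≤ hammingNorm (e + Ehat + u))
    (hw : ((max dA dB : ℕ) : ℝ) * hammingNorm (e + Ehat)
      ≤ ((min dA dB : ℕ) : ℝ) * min (γA * Fintype.card A) (γB * Fintype.card B)) :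
    (hammingNorm (e + Ehat) : ℝ)
      ≤ 4 / (((min dA dB : ℕ) : ℝ) * (1 - 16 * max δA δB) - 2 * κ)
        * ((D ∩ univ.filter fun c => (expanderHX H *ᵥ (e + Ehat)) c ≠ 0).card : ℝ) := by
  classical
  have hdm' : (0 : ℝ) < ((min dA dB : ℕ) : ℝ) := by exact_mod_cast lt_min hdA hdB
  set β : ℝ := 2 * κ / ((min dA dB : ℕ) : ℝ) with hβdef
  have hβ0 : 0 ≤ β := by positivity
  have hβ1 : β < 1 - 16 * max δA δB := by
    rw [hβdef, div_lt_iff₀ hdm']; linarith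
  -- the run behind the output halts at `σ_X(E ⊕ Ê) ⊕ 𝟙_D`
  obtain ⟨l, hrun, hl⟩ := hDec (expanderHX H *ᵥ e + flipVec D)
  have hhalts := (ssfRun_invariants hrun).1
  have hfin : expanderHX H *ᵥ e + flipVec D + expanderHX H *ᵥ runOutput l
      = expanderHX H *ᵥ (e + Ehat) + flipVec D := by
    rw [← hout, hl, Matrix.mulVec_add]; abel
  rw [hfin] at hhalts
  -- the printed halting test holds with `β = 2κ/min Δ`
  have hhalt := haltingTest_of_ssfHalts H hdA hdB hκ0 hhalts
  have h16 := fgl18b_corollary16 H hreg hexp hdA hdB hδA hδB hβ0 hβ1 e Ehat D hhalt hred hw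
  have hden : ((min dA dB : ℕ) : ℝ) * (1 - 16 * max δA δB - β)
      = ((min dA dB : ℕ) : ℝ) * (1 - 16 * max δA δB) - 2 * κ := by
    rw [hβdef]; field_simp
  rw [hden] at h16
  exact h16

/-! ### The adversarial single-shot guarantee (residual reduced weight linear in the syndrome error) -/

omit [DecidableEq A] [DecidableEq B] in
/-- Subadditivity of the Hamming weight. [folklore] -/
private theorem hammingNorm_add_le'' {ι : Type*} [Fintype ι] (x y : ι → ZMod 2) :
    hammingNorm (x + y) ≤ hammingNorm x + hammingNorm y := by
  have h := hammingDist_triangle (x + y) y 0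
  have h1 : hammingDist (x + y) y = hammingNorm x := by
    rw [hammingDist_comm, hammingDist_eq_hammingNorm]
    congr 1; ext i; simp only [Pi.add_apply, Pi.neg_apply]; ring
  rw [hammingDist_zero_right, hammingDist_zero_right, h1] at h
  exact h

/-- **Adversarial single-shot decoding of quantum expander codes** (FGL18b Cor. 16 with its two side conditions
discharged deterministically; this packaging is OURS, the ingredients are the printed Cor. 16, Lemma 15 and the run
accounting of FGL18 Prop. 11). For a `(Δ_A, Δ_B)`-biregular (`Δ ≥ 1`) `(γ_A, δ_A, γ_B, δ_B)`-expanding graph,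
`δ = max(δ_A, δ_B) ≥ 0`, `β₁ = 1 − 16δ`, and EVERY small-set-flip decoder of the tree with threshold `κ`, `0 < κ`,
`2κ < min Δ·β₁`: for every qubit error `E` and every syndrome error `D` with
`max Δ·(|E| + (max Δ·|E| + |D|)/κ) ≤ min Δ·min(γ_A n_A, γ_B n_B)`, the output `Ê` computed from the single noisy
syndrome `σ_X(E) ⊕ 𝟙_D` leaves a residual error `E ⊕ Ê` EQUIVALENT (modulo `C_Z^⊥`) to a word of weight
`≤ 4|D|/(min Δ·β₁ − 2κ)`; in particular `D = ∅` gives correction. Proof: the run pays `κ` per flipped qubit out of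
`|σ_X(E) ⊕ 𝟙_D| ≤ max Δ|E| + |D|`, so `|E ⊕ Ê| ≤ |E| + (max Δ|E| + |D|)/κ`; the reduced representative `E_R` of
`E ⊕ Ê` is not heavier and has the same (halting) observed syndrome, so Cor. 16 applies to it.
[cite: FawziGrospellierLeverrier2018FT, Cor 16 (arXiv p0016 L97 – p0017 L14) and §1 (p0006 L8: "only uses a single noisy syndrome measurement and outputs an error with controlled weight")] -/
theorem ssfDecoder_residual_le_of_syndromeError (H : Matrix B A (ZMod 2)) {dA dB : ℕ} {γA δA γB δB : ℝ}
    (hreg : IsBiregular H dA dB) (hexp : IsLeftRightExpanding H dA dB γA δA γB δB)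
    (hdA : 0 < dA) (hdB : 0 < dB) (hδA : 0 ≤ δA) (hδB : 0 ≤ δB)
    {κ : ℝ} (hκ0 : 0 < κ) (hκ1 : 2 * κ < ((min dA dB : ℕ) : ℝ) * (1 - 16 * max δA δB))
    (Dec : Decoder (A × B → ZMod 2) ((A × A) ⊕ (B × B) → ZMod 2))
    (hDec : IsSSFDecoder κ (expanderHX H) (expanderHZ H) Dec)
    (e : (A × A) ⊕ (B × B) → ZMod 2) (D : Finset (A × B))
    (hsmall : ((max dA dB : ℕ) : ℝ)
        * (hammingNorm e + (((max dA dB : ℕ) : ℝ) * hammingNorm e + D.card) / κ)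
      ≤ ((min dA dB : ℕ) : ℝ) * min (γA * Fintype.card A) (γB * Fintype.card B)) :
    ∃ e' : (A × A) ⊕ (B × B) → ZMod 2,
      e' + (e + Dec (expanderHX H *ᵥ e + flipVec D)) ∈ rowSpace (expanderHZ H) ∧
      (hammingNorm e' : ℝ) ≤ 4 / (((min dA dB : ℕ) : ℝ) * (1 - 16 * max δA δB) - 2 * κ) * D.card := by
  classical
  have hdm' : (0 : ℝ) < ((min dA dB : ℕ) : ℝ) := by exact_mod_cast lt_min hdA hdB
  have hdM' : (0 : ℝ) < ((max dA dB : ℕ) : ℝ) := by exact_mod_cast lt_max_of_lt_left hdA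
  have hδ0 : 0 ≤ max δA δB := le_max_of_le_left hδA
  set β : ℝ := 2 * κ / ((min dA dB : ℕ) : ℝ) with hβdef
  have hβ0 : 0 ≤ β := by positivity
  have hβ1 : β < 1 - 16 * max δA δB := by
    rw [hβdef, div_lt_iff₀ hdm']; linarith
  -- the run behind the output, its halting syndrome and its cost
  obtain ⟨l, hrun, hl⟩ := hDec (expanderHX H *ᵥ e + flipVec D)
  obtain ⟨hhalts, hinv⟩ := ssfRun_invariants hrun
  rw [hl]
  have hfin : expanderHX H *ᵥ e + flipVec D + expanderHX H *ᵥ runOutput l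
      = expanderHX H *ᵥ (e + runOutput l) + flipVec D := by
    rw [Matrix.mulVec_add]; abel
  -- `|σ₀| ≤ max Δ |E| + |D|`
  have hσ₀le : (hammingNorm (expanderHX H *ᵥ e + flipVec D) : ℝ)
      ≤ ((max dA dB : ℕ) : ℝ) * hammingNorm e + D.card := by
    have h1 := hammingNorm_add_le'' (expanderHX H *ᵥ e) (flipVec D)
    have h2 := hammingNorm_expanderHX_mulVec_le_max H hreg e
    rw [hammingNorm_flipVec] at h1
    have : hammingNorm (expanderHX H *ᵥ e + flipVec D) ≤ max dA dB * hammingNorm e + D.card :=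
      h1.trans (Nat.add_le_add_right h2 _)
    exact_mod_cast this
  -- `|Ê| ≤ Σ|Fᵢ| ≤ |σ₀|/κ`
  have hEhat : (hammingNorm (runOutput l) : ℝ) ≤ (((max dA dB : ℕ) : ℝ) * hammingNorm e + D.card) / κ := by
    have h1 : (hammingNorm (runOutput l) : ℝ) ≤ ((l.map Finset.card).sum : ℝ) := by
      exact_mod_cast hammingNorm_runOutput_le l
    have h0 : (0 : ℝ) ≤ hammingNorm (expanderHX H *ᵥ e + flipVec D + expanderHX H *ᵥ runOutput l) :=
      Nat.cast_nonneg _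
    rw [le_div_iff₀ hκ0]
    nlinarith
  -- the reduced representative `E_R` of `E ⊕ Ê`
  obtain ⟨eR, heR, hmin⟩ := exists_wnorm_min (expanderHZ H) hammingNorm (e + runOutput l)
  have hred : ∀ u ∈ rowSpace (expanderHZ H), hammingNorm eR ≤ hammingNorm (eR + u) := by
    intro u hu
    refine hmin _ ?_
    have : eR + u - (e + runOutput l) = (eR - (e + runOutput l)) + u := by abel
    rw [this]
    exact Submodule.add_mem _ heR hu
  have hRle : (hammingNorm eR : ℝ) ≤ hammingNorm (e + runOutput l) := by
    exact_mod_cast hmin (e + runOutput l) (by simp)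
  have hE'le : (hammingNorm (e + runOutput l) : ℝ) ≤ hammingNorm e + hammingNorm (runOutput l) := by
    exact_mod_cast hammingNorm_add_le'' e (runOutput l)
  have hw : ((max dA dB : ℕ) : ℝ) * hammingNorm eR
      ≤ ((min dA dB : ℕ) : ℝ) * min (γA * Fintype.card A) (γB * Fintype.card B) := by
    have h1 : (hammingNorm eR : ℝ)
        ≤ hammingNorm e + (((max dA dB : ℕ) : ℝ) * hammingNorm e + D.card) / κ := by linarith
    exact (mul_le_mul_of_nonneg_left h1 hdM'.le).trans hsmall
  -- same syndrome as `E ⊕ Ê`, hence the halting test holds at `σ_X(E_R) ⊕ 𝟙_D`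
  have hsyn : expanderHX H *ᵥ eR = expanderHX H *ᵥ (e + runOutput l) := by
    have h0 := expanderHX_mulVec_eq_zero_of_mem_rowSpace H heR
    rw [Matrix.mulVec_sub, sub_eq_zero] at h0
    exact h0
  have hhalt := haltingTest_of_ssfHalts H hdA hdB hκ0 hhalts
  rw [hfin, ← hsyn] at hhalt
  -- Cor. 16 for the pair `(E, E_R ⊖ E)`
  have hsum : e + (eR - e) = eR := by abel
  have h16 := fgl18b_corollary16 H hreg hexp hdA hdB hδA hδB hβ0 hβ1 e (eR - e) D
    (by rw [hsum]; exact hhalt) (by rw [hsum]; exact hred) (by rw [hsum]; exact hw)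
  rw [hsum] at h16
  have hden : ((min dA dB : ℕ) : ℝ) * (1 - 16 * max δA δB - β)
      = ((min dA dB : ℕ) : ℝ) * (1 - 16 * max δA δB) - 2 * κ := by
    rw [hβdef]; field_simp
  rw [hden] at h16
  refine ⟨eR, ?_, ?_⟩
  · -- `E_R ⊕ (E ⊕ Ê) = E_R ⊖ (E ⊕ Ê)` in characteristic 2
    have hneg : -(e + runOutput l) = e + runOutput l :=
      funext fun i => ZMod.neg_eq_self_mod_two _
    have : eR + (e + runOutput l) = eR - (e + runOutput l) := by rw [sub_eq_add_neg, hneg]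
    rw [this]
    exact heR
  · have hcpos : 0 ≤ 4 / (((min dA dB : ℕ) : ℝ) * (1 - 16 * max δA δB) - 2 * κ) := by
      apply div_nonneg (by norm_num); linarith
    have hDle : ((D ∩ univ.filter fun c => (expanderHX H *ᵥ eR) c ≠ 0).card : ℝ) ≤ D.card := by
      exact_mod_cast Finset.card_le_card Finset.inter_subset_left
    exact h16.trans (mul_le_mul_of_nonneg_left hDle hcpos)

/-- **`Z`-sector of the single-shot guarantee, in `Q_G`'s own coordinates**: every small-set-flip decoder `Dec` for the
OTHER error type (syndromes `expanderHZ H`, harmless corrections `rowsp(expanderHX H)`, threshold `0 < κ`,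
`2κ < min Δ·β₁`), run on the noisy syndrome `σ_Z(E) ⊕ 𝟙_D`, leaves a residual equivalent modulo `rowsp(expanderHX H)` to
a word of weight `≤ 4|D|/(min Δ·β₁ − 2κ)` under the same budget — the `X`-sector statement for the reversed graph `Gᵀ`
(degrees and `(γ, δ)` pairs exchanged; `min`, `max` are symmetric) transported along the block swap
`(A×A) ⊕ (B×B) ≃ (B×B) ⊕ (A×A)` (`SmallSetFlipRelabel.lean`). ("The decoding algorithm treats `X` and `Z` errors … in a
symmetric fashion".) [cite: FawziGrospellierLeverrier2018FT, §2.4 (arXiv p0011: σ_X := σ_X(E_X) ⊕ D_X, σ_Z := σ_Z(E_Z) ⊕ D_Z) and Cor 16] -/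
theorem ssfDecoder_residual_le_of_syndromeError_zsector (H : Matrix B A (ZMod 2)) {dA dB : ℕ}
    {γA δA γB δB : ℝ} (hreg : IsBiregular H dA dB) (hexp : IsLeftRightExpanding H dA dB γA δA γB δB)
    (hdA : 0 < dA) (hdB : 0 < dB) (hδA : 0 ≤ δA) (hδB : 0 ≤ δB)
    {κ : ℝ} (hκ0 : 0 < κ) (hκ1 : 2 * κ < ((min dA dB : ℕ) : ℝ) * (1 - 16 * max δA δB))
    (Dec : Decoder (B × A → ZMod 2) ((A × A) ⊕ (B × B) → ZMod 2))
    (hDec : IsSSFDecoder κ (expanderHZ H) (expanderHX H) Dec)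
    (e : (A × A) ⊕ (B × B) → ZMod 2) (D : Finset (B × A))
    (hsmall : ((max dA dB : ℕ) : ℝ)
        * (hammingNorm e + (((max dA dB : ℕ) : ℝ) * hammingNorm e + D.card) / κ)
      ≤ ((min dA dB : ℕ) : ℝ) * min (γA * Fintype.card A) (γB * Fintype.card B)) :
    ∃ e' : (A × A) ⊕ (B × B) → ZMod 2,
      e' + (e + Dec (expanderHZ H *ᵥ e + flipVec D)) ∈ rowSpace (expanderHX H) ∧
      (hammingNorm e' : ℝ) ≤ 4 / (((min dA dB : ℕ) : ℝ) * (1 - 16 * max δA δB) - 2 * κ) * D.card := by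
  classical
  set σ := Equiv.sumComm (A × A) (B × B) with hσ
  rw [expanderHZ_eq_submatrix_swap H, expanderHX_eq_submatrix_swap H] at hDec ⊢
  have hD' := isSSFDecoder_comp_equiv σ hDec
  have hregT : IsBiregular Hᵀ dB dA := isBiregular_transpose H hreg
  have hexpT : IsLeftRightExpanding Hᵀ dB dA γB δB γA δA := by
    refine ⟨(isLeftExpanding_transpose_iff H dB γB δB).2 hexp.2, ?_⟩
    have h : IsLeftExpanding Hᵀᵀ dA γA δA := by rw [Matrix.transpose_transpose]; exact hexp.1
    exact (isLeftExpanding_transpose_iff Hᵀ dA γA δA).1 h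
  have hκ1T : 2 * κ < ((min dB dA : ℕ) : ℝ) * (1 - 16 * max δB δA) := by
    rw [min_comm, max_comm]; exact hκ1
  have hnorm : hammingNorm (e ∘ σ.symm) = hammingNorm e := hammingNorm_comp_equiv e σ
  have hsmallT : ((max dB dA : ℕ) : ℝ)
        * (hammingNorm (e ∘ σ.symm) + (((max dB dA : ℕ) : ℝ) * hammingNorm (e ∘ σ.symm) + D.card) / κ)
      ≤ ((min dB dA : ℕ) : ℝ) * min (γB * Fintype.card B) (γA * Fintype.card A) := by
    rw [hnorm, max_comm, min_comm dB, min_comm (γB * _)]; exact hsmall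
  obtain ⟨e', he', hle⟩ := ssfDecoder_residual_le_of_syndromeError Hᵀ hregT hexpT hdB hdA hδB hδA hκ0 hκ1T
    _ hD' (e ∘ σ.symm) D hsmallT
  refine ⟨e' ∘ σ, ?_, ?_⟩
  · rw [mem_rowSpace_submatrix_iff, submatrix_mulVec_eq]
    have hfun : (e' ∘ ⇑σ + (e + Dec (expanderHX Hᵀ *ᵥ (e ∘ ⇑σ.symm) + flipVec D))) ∘ ⇑σ.symm
        = e' + (e ∘ ⇑σ.symm + Dec (expanderHX Hᵀ *ᵥ (e ∘ ⇑σ.symm) + flipVec D) ∘ ⇑σ.symm) := by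
      funext q
      simp [Function.comp]
    rw [hfun]
    exact he'
  · have hn : hammingNorm (e' ∘ σ) = hammingNorm e' := by
      have := hammingNorm_comp_equiv e' σ.symm
      rwa [Equiv.symm_symm] at this
    rw [hn, min_comm, max_comm]
    exact hle

end QuantumExpander

end Literature.InformationTheory.QuantumCodes
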